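import Mathlib
import HarnessLib

/-!
# Stub `stub_lapRecursionSeries` of line `Sketch` — crux `DyadicWallCascade.ViscousContinuation`
# (stmt-AnomalousDissipation-17917)

Sorry-free discharge of the registered stub `stub_lapRecursionSeries` of the lead's skeleton of line
`Sketch` (card lap-map-koopman-transfer, first toy lemma `LapRecursionSeries`) for the crux
`Summit.AnomalousDissipation.AnomalousDissipation.Theses.DyadicWallCascade.ViscousContinuation`
(stmt-AnomalousDissipation-17917).  It is off the composition chain of the line: pure real analysis, no PDE.

**Statement.** For a bijection `τ : α ≃ α` (the lap map of the descending section) and a lap integral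
`I : α → ℝ` bounded by `C`, the Neumann series `g q = ∑ₙ (1/2)^(n+1) I (τ⁻¹^[n+1] q)`
(i) is bounded by the same `C`, (ii) solves the weight-½ Koopman recursion `g (τ q) = (g q + I q)/2`,
and (iii) is the unique bounded solution of that recursion.

**Proof.** Each term is dominated by `C (1/2)^(n+1)`, whose sum is `C`; this gives summability and (i)
(`tsum_of_norm_bounded`).  For (ii), `τ⁻¹^[n+1] (τ q) = τ⁻¹^[n] q`; split off the `n = 0` term and pull
out a factor `1/2`.  For (iii), the difference `d` of two bounded solutions satisfies `d (τ q) = d q / 2`,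
hence `|d q| = |d (τ⁻¹ q)| / 2 ≤ B (1/2)^n` for every `n`, so `d = 0`.
-/

set_option linter.dupNamespace false

noncomputable section

open Filter Topology

namespace Summit.AnomalousDissipation.AnomalousDissipation.Theorems

/-- The geometric majorant `C (1/2)^(n+1)` sums to `C`. [folklore] -/
theorem lapRecursion_series_hasSum_majorant (C : ℝ) :
    HasSum (fun n : ℕ => C * (1 / 2 : ℝ) ^ (n + 1)) C := by
  have h := (hasSum_geometric_of_lt_one (by norm_num : (0 : ℝ) ≤ 1 / 2)
    (by norm_num : (1 / 2 : ℝ) < 1)).mul_left (C / 2)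
  have hf : (fun n : ℕ => C * (1 / 2 : ℝ) ^ (n + 1)) = fun i => C / 2 * (1 / 2 : ℝ) ^ i := by
    funext n
    rw [pow_succ]
    ring
  have hC : C / 2 * (1 - 1 / 2 : ℝ)⁻¹ = C := by ring
  rw [hC] at h
  rw [hf]
  exact h

/-- Termwise domination of the weighted sequence by the geometric majorant. [folklore] -/
theorem lapRecursion_series_norm_term_le (f : ℕ → ℝ) (C : ℝ) (hf : ∀ n, |f n| ≤ C) (n : ℕ) :
    ‖(1 / 2 : ℝ) ^ (n + 1) * f n‖ ≤ C * (1 / 2 : ℝ) ^ (n + 1) := by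
  rw [Real.norm_eq_abs, abs_mul, abs_of_pos (by positivity : (0 : ℝ) < (1 / 2) ^ (n + 1)), mul_comm]
  exact mul_le_mul_of_nonneg_right (hf n) (by positivity)

/-- Summability of a geometrically weighted bounded sequence. [folklore] -/
theorem lapRecursion_series_summable (f : ℕ → ℝ) (C : ℝ) (hf : ∀ n, |f n| ≤ C) :
    Summable (fun n : ℕ => (1 / 2 : ℝ) ^ (n + 1) * f n) :=
  Summable.of_norm_bounded (lapRecursion_series_hasSum_majorant C).summable
    (lapRecursion_series_norm_term_le f C hf)

/-- The weighted sum of a sequence bounded by `C` is bounded by `C`. [folklore] -/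
theorem lapRecursion_series_abs_tsum_le (f : ℕ → ℝ) (C : ℝ) (hf : ∀ n, |f n| ≤ C) :
    |∑' n : ℕ, (1 / 2 : ℝ) ^ (n + 1) * f n| ≤ C := by
  rw [← Real.norm_eq_abs]
  exact tsum_of_norm_bounded (lapRecursion_series_hasSum_majorant C)
    (lapRecursion_series_norm_term_le f C hf)

/-- The Neumann series solves the weight-½ Koopman recursion `g (τ q) = (g q + I q) / 2`. [folklore] -/
theorem lapRecursion_series_step {α : Type*} (τ : α ≃ α) (I : α → ℝ) (C : ℝ)
    (hI : ∀ q, |I q| ≤ C) (q : α) :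
    (∑' n : ℕ, (1 / 2 : ℝ) ^ (n + 1) * I ((⇑τ.symm)^[n + 1] (τ q))) =
      ((∑' n : ℕ, (1 / 2 : ℝ) ^ (n + 1) * I ((⇑τ.symm)^[n + 1] q)) + I q) / 2 := by
  have h1 : (∑' n : ℕ, (1 / 2 : ℝ) ^ (n + 1) * I ((⇑τ.symm)^[n + 1] (τ q))) =
      ∑' n : ℕ, (1 / 2 : ℝ) ^ (n + 1) * I ((⇑τ.symm)^[n] q) :=
    tsum_congr fun n => by rw [Function.iterate_succ_apply, Equiv.symm_apply_apply]
  have hs : Summable (fun n : ℕ => (1 / 2 : ℝ) ^ (n + 1) * I ((⇑τ.symm)^[n] q)) :=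
    lapRecursion_series_summable (fun n => I ((⇑τ.symm)^[n] q)) C (fun n => hI _)
  have h2 : (∑' n : ℕ, (1 / 2 : ℝ) ^ (n + 1 + 1) * I ((⇑τ.symm)^[n + 1] q)) =
      (1 / 2 : ℝ) * ∑' n : ℕ, (1 / 2 : ℝ) ^ (n + 1) * I ((⇑τ.symm)^[n + 1] q) := by
    rw [← tsum_mul_left]
    exact tsum_congr fun n => by ring
  rw [h1, hs.tsum_eq_zero_add, h2, Function.iterate_zero_apply]
  ring

/-- Uniqueness: two bounded solutions of the weight-½ Koopman recursion coincide. [folklore] -/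
theorem lapRecursion_series_unique {α : Type*} (τ : α ≃ α) (I S g : α → ℝ) (B : ℝ)
    (hB : ∀ q, |g q - S q| ≤ B) (hS : ∀ q, S (τ q) = (S q + I q) / 2)
    (hg : ∀ q, g (τ q) = (g q + I q) / 2) (q : α) : g q = S q := by
  have hd : ∀ q, g (τ q) - S (τ q) = (g q - S q) / 2 := fun q => by
    rw [hS, hg]
    ring
  have key : ∀ n : ℕ, ∀ q, |g q - S q| ≤ B * (1 / 2 : ℝ) ^ n := by
    intro n
    induction n with
    | zero =>
      intro q
      simpa using hB q
    | succ n ih =>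
      intro q
      have h := hd (τ.symm q)
      rw [Equiv.apply_symm_apply] at h
      rw [h, abs_div, abs_two]
      calc |g (τ.symm q) - S (τ.symm q)| / 2 ≤ B * (1 / 2 : ℝ) ^ n / 2 := by gcongr; exact ih _
        _ = B * (1 / 2 : ℝ) ^ (n + 1) := by ring
  have hlim : Tendsto (fun n : ℕ => B * (1 / 2 : ℝ) ^ n) atTop (𝓝 (B * 0)) :=
    (tendsto_pow_atTop_nhds_zero_of_lt_one (by norm_num) (by norm_num)).const_mul B
  rw [mul_zero] at hlim
  have h0 : |g q - S q| ≤ 0 := ge_of_tendsto' hlim fun n => key n q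
  exact sub_eq_zero.mp (abs_nonpos_iff.mp h0)

/-- **Stub (toy, S) — lap-recursion Neumann series** (card lap-map-koopman-transfer, First lemma
`LapRecursionSeries`; registered stub `stub_lapRecursionSeries` of line `Sketch`, crux
stmt-AnomalousDissipation-17917): for a bijection `τ` (the lap map on the descending section) and a
bounded lap integral `I`, the series `g q = ∑ₙ (1/2)^(n+1) I (τ⁻¹^[n+1] q)` is bounded by the same
constant, solves the weight-½ Koopman recursion `g (τ q) = (g q + I q)/2`, and is the unique bounded
solution. [folklore] -/
theorem stub_lapRecursionSeries : ∀ {α : Type*} (τ : α ≃ α) (I : α → ℝ) (C : ℝ), (∀ q, |I q| ≤ C) → (∀ q, |∑' n : ℕ, (1 / 2 : ℝ) ^ (n + 1) * I ((⇑τ.symm)^[n + 1] q)| ≤ C) ∧ (∀ q, (∑' n : ℕ, (1 / 2 : ℝ) ^ (n + 1) * I ((⇑τ.symm)^[n + 1] (τ q))) = ((∑' n : ℕ, (1 / 2 : ℝ) ^ (n + 1) * I ((⇑τ.symm)^[n + 1] q)) + I q) / 2) ∧ (∀ g : α → ℝ, (∃ C' : ℝ, ∀ q, |g q| ≤ C')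 → (∀ q, g (τ q) = (g q + I q) / 2) → ∀ q, g q = ∑' n : ℕ, (1 / 2 : ℝ) ^ (n + 1) * I ((⇑τ.symm)^[n + 1] q)) := by
  intro α τ I C hI
  have hb : ∀ q, |∑' n : ℕ, (1 / 2 : ℝ) ^ (n + 1) * I ((⇑τ.symm)^[n + 1] q)| ≤ C := fun q =>
    lapRecursion_series_abs_tsum_le (fun n => I ((⇑τ.symm)^[n + 1] q)) C (fun n => hI _)
  have hrec := lapRecursion_series_step τ I C hI
  refine ⟨hb, hrec, ?_⟩
  rintro g ⟨C', hC'⟩ hg q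
  refine lapRecursion_series_unique τ I
    (fun q => ∑' n : ℕ, (1 / 2 : ℝ) ^ (n + 1) * I ((⇑τ.symm)^[n + 1] q)) g (C' + C) ?_ hrec hg q
  intro q
  exact (abs_sub _ _).trans (add_le_add (hC' q) (hb q))

end Summit.AnomalousDissipation.AnomalousDissipation.Theorems

end
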